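import Literature.AlgebraicGeometry.HodgeTheory.VHSDataPunctureChart
import Literature.AlgebraicGeometry.HodgeTheory.VHSDataHodgeLocusOverPuncturedCompactCurve
import Literature.AlgebraicGeometry.Motives.HodgeStructureTensorHodgeNorm
import HarnessLib

/-!
# Interior local period charts of a polarized `ℤ`-variation, bundled, THE INTERIOR CHART OF `D₁ ⊗ D₂`, and Cattani–Deligne–Kaplan's
# Theorem 1.1 (`r = 1`) for the tensor product `D₁ ⊗ D₂` over a curve from the charts of the factors

Topic `Literature/AlgebraicGeometry/HodgeTheory` (namespaces `Literature.AlgebraicGeometry.Motives.VHSData[.InteriorChart]`,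
`….Motives.HodgeStructure`), lane `lit-hodgefound` (seat `p08`, row g58-#3); the interior companion of `HodgeTheory/VHSDataPunctureChart.lean`
(puncture charts and their tensor product).  DEFINITIONS WITH BODIES (`VHSData.InteriorChart` — the hypotheses of `VHSDataHodgeLocusInteriorChart`
bundled for ALL filtration steps, with an invertible frame and the metric comparison on all of `V_ℂ` —, `InteriorChart.tensor`) and THEOREMS; no
named fact, no instance, no notation (D-0026 net debt `0`).

PRINTED SOURCES, VERBATIM.  E. Cattani, P. Deligne, A. Kaplan, *On the locus of Hodge classes*, J. AMS 8 (1995): §1 (p. 483) «at `h ∈ H_ℤ` of type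
`(p, p)`, the locus `T ⊂ U` where `h` remains of type `(p, p)`, i.e., in `ℱ^p`, is a complex analytic subspace of `U`»; (p. 484) «the hermitian form
`h(u, v) = Q(Cu, v̄)` is positive definite … Fix an integer `K` and let `S^{(K)}` be the space of pairs `(s, u)` with `s ∈ S`, `u ∈ 𝒱_s` integral of
type `(0, 0)`, and `Q(u, u) ≤ K` … locally on `S`, `S^{(K)}` is a finite disjoint sum of closed analytic subspaces»; Thm. 1.1 / Cor. 1.2 (p. 484);
«Proof of 1.5 ⟹ 1.1» (p. 485).  W. Schmid, *Variation of Hodge structure*, Invent. Math. 22 (1973), §2 (flat trivializations; variations are stable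
under `⊗`), §3 (period maps).  P. Deligne, *Théorie de Hodge II*, 1.1.12, 2.1.15 (`F^p(V ⊗ W) = Σ F^a ⊗ F^b`, product polarization).  Later
literature: the «tensorial Hodge locus» `HL(S, 𝕍^⊗)` (Klingler–Otwinowska–Urbanik §1.1).

CONTENT.
* §0 units: `comap` along an invertible endomorphism is `map` along the inverse; **`A ⊗ B` is invertible with `A`, `B`** (`isUnit_tensorEnd`,
  `comap_tensorEnd_units_eq_map`), and **the Hodge filtration of `H₁ ⊗ H₂` pulled back along `h₁ ⊗ h₂`** for invertible frames:
  `fᵢ,ℂF^q(Hᵢ) = hᵢ⁻¹F^q(H₀ᵢ)` for all `q` ⟹ `(f₁ ⊗ f₂)_ℂF^q(H₁ ⊗ H₂) = (h₁ ⊗ h₂)⁻¹F^q(H₀₁ ⊗ H₀₂)` (`map_tensor_F_eq_comap_tensorEnd`, from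
  `VHSDataPunctureChart`'s `HodgeStructure.map_tensor_F_eq_of_forall`).
* §1 **`VHSData.InteriorChart D ψ P₀`**: coordinate chart `ψ` with preconnected target; flat trivializations `e c : V_{ψ⁻¹(c)} ≃ V` (`c ∈ ψ.target`)
  carrying every `F^q` to `h(c)⁻¹F₀^q` (`h(c)` invertible, holomorphic coefficients), `Q` to `Q₀`, `V_ℤ` ONTO a finitely generated `Λ`; a uniform
  comparison `κ‖e_c,ℂ x‖₀ ≤ ‖x‖` on all of `V_{ψ⁻¹(c),ℂ}` (it implies the tree's rational-vector form, `mul_hodgeNorm_ofRat_le`); re-exports of the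
  interior dichotomies (`subset_or_eventually_not_mem`, `mem_nhds_or_eventually_not_mem`).
* §2 **`InteriorChart.tensor`** (same `ψ`; reference spaces in `Type`, the universe of the fibres): reference `(H₀₁ ⊗ H₀₂, Q₀₁ ⊗ Q₀₂)`,
  trivialization `e₁ ⊗ e₂`, inverse frame `h₁ ⊗ h₂`, lattice `Λ₁ ⊗ Λ₂`, constant `κ₁κ₂` — the metric comparison by
  `Motives/HodgeStructureTensorHodgeNorm` (`‖(e₁ ⊗ e₂)w‖₀ ≤ κ₁⁻¹κ₂⁻¹‖w‖`).
* §3 **Thm. 1.1 / Cor. 1.2 (`r = 1`) from BUNDLED charts** (`hodgeLocusOfNormLe_eq_univ_or_finite_of_charts`, `…_of_charts_of_compactification`: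
  the tree's `hodgeLocusOfNormLe_eq_univ_or_finite_of_local` fed with `InteriorChart` ∕ `PunctureChart`; punctured compact curve model of
  `VHSDataHodgeLocusOverPuncturedCompactCurve`).
* §4 **THM. 1.1 / COR. 1.2 FOR `D₁ ⊗ D₂` OVER A CURVE FROM THE CHARTS OF THE FACTORS** (`hodgeLocusOfNormLe_tensor_eq_univ_or_finite`,
  `…_of_compactification`): with interior charts of `D₁`, `D₂` on common coordinate discs and puncture charts along common uniformisations, the
  set of points carrying a nonzero integral tensor of type `(p, p)` (`2p = k₁ + k₂`) with `(Q₁ ⊗ Q₂)(u, u) ≤ K` is all of `S` or finite.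

HONEST SCOPE.  Charts are HYPOTHESIS structures (for honest polarized `ℤ`VHS on a curve they come from simply connected coordinate discs, the
holomorphy of the Hodge bundles and the nilpotent orbit theorem — cite only); this file and `VHSDataPunctureChart` show the hypotheses are
stable under `⊗`.  Not here: duals, Tate twists, tensor powers `T^{a,b}`; several variables.

## References

* [CattaniDeligneKaplan1995] E. Cattani, P. Deligne, A. Kaplan, *On the locus of Hodge classes*, J. Amer. Math. Soc. 8 (1995) 483–506: §1
  (pp. 483–484), Thm. 1.1, Cor. 1.2, Thm. 1.5, «Proof of 1.5 ⟹ 1.1» (p. 485), 2.3 (p. 487).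
* [Schmid1973] W. Schmid, *Variation of Hodge structure: the singularities of the period mapping*, Invent. Math. 22 (1973), §2, §3 (cite only).
* [DeligneHodgeII1971] P. Deligne, *Théorie de Hodge II*, Publ. Math. IHÉS 40 (1971), 1.1.12, 2.1.15.
* [CattaniElZeinGriffithsLe2014] E. Cattani et al. (eds.), *Hodge Theory*, Math. Notes 49 (2014), §3.1.1.3 (1), §3.2.2.7 (1)(iii).
* [VoisinHodgeII2003] C. Voisin, *Hodge Theory and Complex Algebraic Geometry II* (2003), §5.3.1 (the Hodge locus of a flat class is analytic).
* [FritzscheGrauert2002] K. Fritzsche, H. Grauert, *From Holomorphic Functions to Complex Manifolds*, GTM 213 (2002), Ch. I §8.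
* [KlinglerOtwinowskaUrbanik2023] B. Klingler, A. Otwinowska, D. Urbanik, *On the fields of definition of Hodge loci*, Ann. Sci. ÉNS 56 (2023),
  §1.1 (context only).
-/

noncomputable section

open scoped TensorProduct ComplexOrder
open _root_.Topology _root_.Filter Set

namespace Literature.AlgebraicGeometry

open Module
open Motives Motives.MixedHodgeStructure Motives.HodgeStructure
open Motives.HodgeStructure (conj ofRat ofRat_apply conj_ofRat tensorBaseChange tensorEnd tensorBaseChange_tmul)
open HodgeTheory

universe u

/-! ## §0 Units: `comap` along an invertible endomorphism is `map` along the inverse; `A ⊗ B` is invertible with `A`, `B` -/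

namespace Motives.HodgeStructure

variable {V₁ V₂ : Type u} [AddCommGroup V₁] [Module ℚ V₁] [AddCommGroup V₂] [Module ℚ V₂]

/-- `comap` along a unit of `End` is `map` along its inverse. [folklore] -/
private theorem comap_unit_eq_map_inv {R M : Type*} [CommRing R] [AddCommGroup M] [Module R M] (u : (Module.End R M)ˣ) (S : Submodule R M) :
    S.comap (u : Module.End R M) = S.map (↑u⁻¹ : Module.End R M) := by
  ext x
  constructor
  · intro hx
    exact ⟨(u : Module.End R M) x, hx, by rw [← Module.End.mul_apply, Units.inv_mul, Module.End.one_apply]⟩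
  · rintro ⟨y, hy, rfl⟩
    show (u : Module.End R M) ((↑u⁻¹ : Module.End R M) y) ∈ S
    rwa [← Module.End.mul_apply, Units.mul_inv, Module.End.one_apply]

/-- For an invertible `h`, `h⁻¹(S) = u⁻¹ • S` with `u` the unit of `h`. [folklore] -/
private theorem comap_eq_map_unit_inv {R M : Type*} [CommRing R] [AddCommGroup M] [Module R M] {h : Module.End R M} (hu : IsUnit h)
    (S : Submodule R M) : S.comap h = S.map (↑hu.unit⁻¹ : Module.End R M) := by
  rw [← comap_unit_eq_map_inv hu.unit S, IsUnit.unit_spec]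

/-- **`A ⊗ B` is invertible when `A` and `B` are, with inverse `A⁻¹ ⊗ B⁻¹`**: `comap` along `a ⊗ b` is `map` along `a⁻¹ ⊗ b⁻¹`.
[cite: CattaniElZeinGriffithsLe2014, §3.1.1.3 (1)] -/
theorem comap_tensorEnd_units_eq_map (a : (Module.End ℂ (ℂ ⊗[ℚ] V₁))ˣ) (b : (Module.End ℂ (ℂ ⊗[ℚ] V₂))ˣ) (S : Submodule ℂ (ℂ ⊗[ℚ] (V₁ ⊗[ℚ] V₂))) :
    S.comap (tensorEnd (a : Module.End ℂ (ℂ ⊗[ℚ] V₁)) (b : Module.End ℂ (ℂ ⊗[ℚ] V₂))) =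
      S.map (tensorEnd (↑a⁻¹ : Module.End ℂ (ℂ ⊗[ℚ] V₁)) (↑b⁻¹ : Module.End ℂ (ℂ ⊗[ℚ] V₂))) :=
  comap_unit_eq_map_inv ⟨tensorEnd (a : Module.End ℂ (ℂ ⊗[ℚ] V₁)) (b : Module.End ℂ (ℂ ⊗[ℚ] V₂)),
    tensorEnd (↑a⁻¹ : Module.End ℂ (ℂ ⊗[ℚ] V₁)) (↑b⁻¹ : Module.End ℂ (ℂ ⊗[ℚ] V₂)),
    by rw [← tensorEnd_mul, Units.mul_inv, Units.mul_inv, tensorEnd_one],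
    by rw [← tensorEnd_mul, Units.inv_mul, Units.inv_mul, tensorEnd_one]⟩ S

/-- **`A ⊗ B` is invertible when `A` and `B` are.** [cite: CattaniElZeinGriffithsLe2014, §3.1.1.3 (1)] -/
theorem isUnit_tensorEnd {A : Module.End ℂ (ℂ ⊗[ℚ] V₁)} {B : Module.End ℂ (ℂ ⊗[ℚ] V₂)} (hA : IsUnit A) (hB : IsUnit B) :
    IsUnit (tensorEnd A B) := by
  obtain ⟨a, rfl⟩ := hA
  obtain ⟨b, rfl⟩ := hB
  exact ⟨⟨tensorEnd (a : Module.End ℂ (ℂ ⊗[ℚ] V₁)) (b : Module.End ℂ (ℂ ⊗[ℚ] V₂)),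
    tensorEnd (↑a⁻¹ : Module.End ℂ (ℂ ⊗[ℚ] V₁)) (↑b⁻¹ : Module.End ℂ (ℂ ⊗[ℚ] V₂)),
    by rw [← tensorEnd_mul, Units.mul_inv, Units.mul_inv, tensorEnd_one],
    by rw [← tensorEnd_mul, Units.inv_mul, Units.inv_mul, tensorEnd_one]⟩, rfl⟩

/-- **The Hodge filtration of a tensor product of pure Hodge structures pulled back along `h₁ ⊗ h₂` for INVERTIBLE `hᵢ`**: if `fᵢ,ℂ F^q(Hᵢ) =
hᵢ⁻¹F^q(H₀ᵢ)` for all `q`, then `(f₁ ⊗ f₂)_ℂ F^q(H₁ ⊗ H₂) = (h₁ ⊗ h₂)⁻¹ F^q(H₀₁ ⊗ H₀₂)` («`ℱ^p` varies holomorphically»: holomorphic frames of the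
factors give a holomorphic frame of the tensor product). [cite: DeligneHodgeII1971, (1.1.12)] [cite: CattaniElZeinGriffithsLe2014, §3.2.2.7 (1)(iii)] -/
theorem map_tensor_F_eq_comap_tensorEnd [HodgeTensorFacts.{0, 0}] [HodgeTensorFacts.{u, u}] {M₁ M₂ : Type} [AddCommGroup M₁] [Module ℚ M₁]
    [AddCommGroup M₂] [Module ℚ M₂] [FiniteDimensional ℚ M₁] [FiniteDimensional ℚ M₂] [FiniteDimensional ℚ V₁] [FiniteDimensional ℚ V₂]
    {n m : ℤ} (H₁ : HodgeStructure M₁ n) (H₂ : HodgeStructure M₂ m) (H₀₁ : HodgeStructure V₁ n) (H₀₂ : HodgeStructure V₂ m)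
    (f₁ : M₁ →ₗ[ℚ] V₁) (f₂ : M₂ →ₗ[ℚ] V₂) {h₁ : Module.End ℂ (ℂ ⊗[ℚ] V₁)} {h₂ : Module.End ℂ (ℂ ⊗[ℚ] V₂)} (hu₁ : IsUnit h₁) (hu₂ : IsUnit h₂)
    (hF₁ : ∀ q : ℤ, (H₁.F q).map (f₁.baseChange ℂ) = (H₀₁.F q).comap h₁) (hF₂ : ∀ q : ℤ, (H₂.F q).map (f₂.baseChange ℂ) = (H₀₂.F q).comap h₂)
    (q : ℤ) : ((H₁.tensor H₂).F q).map ((TensorProduct.map f₁ f₂).baseChange ℂ) = ((H₀₁.tensor H₀₂).F q).comap (tensorEnd h₁ h₂) := by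
  have hF₁' : ∀ q : ℤ, (H₁.F q).map (f₁.baseChange ℂ) = (H₀₁.toMixedHodgeStructure.F q).map (↑hu₁.unit⁻¹ : Module.End ℂ (ℂ ⊗[ℚ] V₁)) := fun q => by
    rw [hF₁ q, comap_eq_map_unit_inv hu₁, HodgeStructure.toMixedHodgeStructure_F]
  have hF₂' : ∀ q : ℤ, (H₂.F q).map (f₂.baseChange ℂ) = (H₀₂.toMixedHodgeStructure.F q).map (↑hu₂.unit⁻¹ : Module.End ℂ (ℂ ⊗[ℚ] V₂)) := fun q => by
    rw [hF₂ q, comap_eq_map_unit_inv hu₂, HodgeStructure.toMixedHodgeStructure_F]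
  have hR : (H₀₁.tensor H₀₂).F q = (MixedHodgeStructure.tensor H₀₁.toMixedHodgeStructure H₀₂.toMixedHodgeStructure).F q := by
    have h := congrArg (fun H : MixedHodgeStructure (V₁ ⊗[ℚ] V₂) => H.F q) (HodgeStructure.toMixedHodgeStructure_tensor H₀₁ H₀₂)
    simp only [HodgeStructure.toMixedHodgeStructure_F] at h
    exact h
  rw [hR, ← hu₁.unit_spec, ← hu₂.unit_spec, comap_tensorEnd_units_eq_map]
  exact HodgeStructure.map_tensor_F_eq_of_forall H₁ H₂ H₀₁.toMixedHodgeStructure H₀₂.toMixedHodgeStructure f₁ f₂ _ _ hF₁' hF₂' q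

end Motives.HodgeStructure

/-! ## §1 Interior local period charts, bundled -/

namespace Motives.VHSData

variable {S : Type} [TopologicalSpace S] {k : ℤ}
variable {V : Type u} [AddCommGroup V] [Module ℚ V] [FiniteDimensional ℚ V]

/-- **A LOCAL HOLOMORPHIC PERIOD CHART of the datum `D : VHSData S k` at an interior point** — the hypotheses of
`VHSDataHodgeLocusInteriorChart` bundled, for ALL steps of the Hodge filtration and with an INVERTIBLE holomorphic frame: a coordinate chart
`ψ : S → ℂ` with preconnected target, a reference polarized Hodge structure `(H₀, P₀)` on `V`, for `c ∈ ψ.target` flat identifications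
`e c : V_{ψ⁻¹(c)} ≃ V` carrying EVERY `F^q` to `h(c)⁻¹F₀^q` with `h(c)` invertible and its matrix coefficients holomorphic on the target («`ℱ^p`
varies holomorphically»: `h = g⁻¹` for a holomorphic lift `g` of the period map), `Q` to `Q₀ = P₀.form`, `V_ℤ` ONTO a finitely generated
lattice `Λ`, and a UNIFORM COMPARISON of Hodge metrics `κ‖e_c,ℂ(x)‖₀ ≤ ‖x‖_{ψ⁻¹(c)}` on all of `V_{ψ⁻¹(c),ℂ}`, `κ > 0` («the hermitian form
`h(u, v) = Q(Cu, v̄)` is positive definite»; continuity of the Hodge metric on a relatively compact chart).  For `D` underlying an honest polarized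
`ℤ`VHS such charts exist at every point (simply connected coordinate discs; not constructed here). [cite: CattaniDeligneKaplan1995, §1 (pp. 483–484)]
[cite: Schmid1973, §2 and §3 (cite only)] [cite: VoisinHodgeII2003, §5.3.1] -/
structure InteriorChart (D : VHSData S k) (ψ : OpenPartialHomeomorph S ℂ) {H₀ : HodgeStructure V k} (P₀ : H₀.Polarization) where
  /-- the coordinate disc is connected -/
  isPreconnected_target : IsPreconnected ψ.target
  /-- the flat trivialization `e c : V_{ψ⁻¹(c)} ≃ V` -/
  e : ∀ c : ℂ, D.V.fiber (ψ.symm c) ≃ₗ[ℚ] V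
  /-- the inverse holomorphic frame `h(c) = g(c)⁻¹` -/
  h : ℂ → Module.End ℂ (ℂ ⊗[ℚ] V)
  /-- the matrix coefficients of `h` are holomorphic on the target -/
  analyticOnNhd_h : ∀ (φ : Module.Dual ℂ (ℂ ⊗[ℚ] V)) (w : ℂ ⊗[ℚ] V), AnalyticOnNhd ℂ (fun c => φ (h c w)) ψ.target
  /-- `h(c)` is invertible -/
  isUnit_h : ∀ c ∈ ψ.target, IsUnit (h c)
  /-- `e_c(F^q) = h(c)⁻¹ F₀^q` for every `q` -/
  map_F_eq : ∀ c ∈ ψ.target, ∀ q : ℤ, ((D.hodge (ψ.symm c)).F q).map ((e c).toLinearMap.baseChange ℂ) = (H₀.F q).comap (h c)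
  /-- `e_c` carries `Q` to `Q₀` -/
  form_eq : ∀ c ∈ ψ.target, ∀ x y : D.V.fiber (ψ.symm c), (D.form (ψ.symm c)).form x y = P₀.form (e c x) (e c y)
  /-- the lattice `Λ = V_ℤ ⊆ V` -/
  Λ : Submodule ℤ V
  /-- `Λ` is finitely generated -/
  fg_Λ : Λ.FG
  /-- `e_c(V_ℤ) ⊆ Λ` -/
  e_toRat_mem : ∀ c ∈ ψ.target, ∀ u : D.VZ.fiber (ψ.symm c), e c (D.toRat (ψ.symm c) u) ∈ Λ
  /-- `Λ ⊆ e_c(V_ℤ)` -/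
  exists_e_toRat_eq : ∀ c ∈ ψ.target, ∀ v ∈ Λ, ∃ u : D.VZ.fiber (ψ.symm c), e c (D.toRat (ψ.symm c) u) = v
  /-- the comparison constant of the Hodge metrics -/
  κ : ℝ
  /-- `κ > 0` -/
  κ_pos : 0 < κ
  /-- `κ‖e_c,ℂ(x)‖₀ ≤ ‖x‖` for every `x ∈ V_{ψ⁻¹(c),ℂ}` -/
  mul_hodgeNorm_le : ∀ c ∈ ψ.target, ∀ x : ℂ ⊗[ℚ] D.V.fiber (ψ.symm c),
    κ * P₀.hodgeNorm ((e c).toLinearMap.baseChange ℂ x) ≤ (D.form (ψ.symm c)).hodgeNorm x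

namespace InteriorChart

variable {D : VHSData S k} {ψ : OpenPartialHomeomorph S ℂ} {H₀ : HodgeStructure V k} {P₀ : H₀.Polarization} (C : D.InteriorChart ψ P₀)

omit [FiniteDimensional ℚ V] in
/-- The comparison on rational vectors: `κ‖1 ⊗ e_c(x)‖₀ ≤ ‖1 ⊗ x‖` (the form used by `VHSDataHodgeLocusInteriorChart`). [cite: CattaniDeligneKaplan1995, §1 (p. 484)] -/
theorem mul_hodgeNorm_ofRat_le {c : ℂ} (hc : c ∈ ψ.target) (x : D.V.fiber (ψ.symm c)) :
    C.κ * P₀.hodgeNorm (ofRat (C.e c x)) ≤ (D.form (ψ.symm c)).hodgeNorm (ofRat x) := by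
  have h := C.mul_hodgeNorm_le c hc (ofRat x)
  rwa [ofRat_apply, LinearMap.baseChange_tmul] at h

/-- **On the chart: EVERYTHING, or every point has a punctured neighbourhood off the locus** (`mem_nhds_or_eventually_not_mem_hodgeLocusOfNormLe_of_chart`
on a bundled chart): `ψ.source ⊆ hodgeLocusOfNormLe D p K`, or every `x ∈ ψ.source` has a punctured neighbourhood avoiding the locus.
[cite: CattaniDeligneKaplan1995, §1 (pp. 483–484), Thm. 1.1] [cite: FritzscheGrauert2002, Ch. I §8] -/
theorem subset_or_eventually_not_mem (C : D.InteriorChart ψ P₀) {p : ℤ} (hpk : p + p = k) (K : ℤ) :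
    ψ.source ⊆ D.hodgeLocusOfNormLe p K ∨ ∀ x ∈ ψ.source, ∀ᶠ y in 𝓝[≠] x, y ∉ D.hodgeLocusOfNormLe p K :=
  D.mem_nhds_or_eventually_not_mem_hodgeLocusOfNormLe_of_chart hpk ψ C.isPreconnected_target C.e H₀ P₀ C.h C.analyticOnNhd_h
    (fun c hc => C.map_F_eq c hc p) C.form_eq C.Λ C.fg_Λ C.e_toRat_mem C.exists_e_toRat_eq C.κ_pos (fun _ hc x => C.mul_hodgeNorm_ofRat_le hc x) K

/-- **At a point of the chart: the Hodge locus of norm `≤ K` is a neighbourhood, or is avoided by a punctured neighbourhood**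
(`mem_nhds_or_eventually_not_mem_hodgeLocusOfNormLe_at` on a bundled chart). [cite: CattaniDeligneKaplan1995, §1 (pp. 483–484), Thm. 1.1] -/
theorem mem_nhds_or_eventually_not_mem (C : D.InteriorChart ψ P₀) {p : ℤ} (hpk : p + p = k) (K : ℤ) {x : S} (hx : x ∈ ψ.source) :
    D.hodgeLocusOfNormLe p K ∈ 𝓝 x ∨ ∀ᶠ y in 𝓝[≠] x, y ∉ D.hodgeLocusOfNormLe p K :=
  D.mem_nhds_or_eventually_not_mem_hodgeLocusOfNormLe_at hpk ψ C.isPreconnected_target C.e H₀ P₀ C.h C.analyticOnNhd_h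
    (fun c hc => C.map_F_eq c hc p) C.form_eq C.Λ C.fg_Λ C.e_toRat_mem C.exists_e_toRat_eq C.κ_pos (fun _ hc x => C.mul_hodgeNorm_ofRat_le hc x) K hx

end InteriorChart

/-! ## §2 The interior chart of `D₁ ⊗ D₂` -/

namespace InteriorChart

variable {k₁ k₂ : ℤ} {D₁ : VHSData S k₁} {D₂ : VHSData S k₂} {ψ : OpenPartialHomeomorph S ℂ}
variable {V₁ V₂ : Type} [AddCommGroup V₁] [Module ℚ V₁] [FiniteDimensional ℚ V₁] [AddCommGroup V₂] [Module ℚ V₂] [FiniteDimensional ℚ V₂]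
variable {H₀₁ : HodgeStructure V₁ k₁} {H₀₂ : HodgeStructure V₂ k₂} {P₀₁ : H₀₁.Polarization} {P₀₂ : H₀₂.Polarization}
variable [HodgeTensorFacts.{0, 0}] (C₁ : D₁.InteriorChart ψ P₀₁) (C₂ : D₂.InteriorChart ψ P₀₂)

/-- **THE TENSOR PRODUCT OF TWO INTERIOR CHARTS ON THE SAME COORDINATE DISC**: the chart of `D₁ ⊗ D₂` with reference structure
`(H₀₁ ⊗ H₀₂, Q₀₁ ⊗ Q₀₂)`, trivialization `e₁ ⊗ e₂`, inverse frame `h₁(c) ⊗ h₂(c)` (invertible, holomorphic coefficients: `(h₁ ⊗ h₂)⁻¹(Σ F₀₁^a ⊗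
F₀₂^b) = Σ h₁⁻¹F₀₁^a ⊗ h₂⁻¹F₀₂^b`), lattice `Λ₁ ⊗ Λ₂`, and comparison constant `κ₁κ₂` (the Hodge metric of a tensor product is the tensor norm:
`Motives/HodgeStructureTensorHodgeNorm`).  The reference spaces `V₁`, `V₂` are taken in `Type` (the universe of the fibres).
[cite: CattaniDeligneKaplan1995, §1 (pp. 483–484)] [cite: DeligneHodgeII1971, (1.1.12) and 2.1.15] [cite: Schmid1973, §2] -/
def tensor : (D₁.tensor D₂).InteriorChart ψ (P₀₁.tensor P₀₂) where
  isPreconnected_target := C₁.isPreconnected_target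
  e c := tensorTriv D₁ D₂ (C₁.e c) (C₂.e c)
  h c := tensorEnd (C₁.h c) (C₂.h c)
  analyticOnNhd_h φ w c hc := analyticAt_apply_tensorEnd (fun φ w => C₁.analyticOnNhd_h φ w c hc) (fun φ w => C₂.analyticOnNhd_h φ w c hc) φ w
  isUnit_h c hc := isUnit_tensorEnd (C₁.isUnit_h c hc) (C₂.isUnit_h c hc)
  map_F_eq c hc q := by
    haveI : Module.Finite ℚ (D₁.V.fiber (ψ.symm c)) := D₁.finite_fiber _
    haveI : Module.Finite ℚ (D₂.V.fiber (ψ.symm c)) := D₂.finite_fiber _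
    exact map_tensor_F_eq_comap_tensorEnd (D₁.hodge (ψ.symm c)) (D₂.hodge (ψ.symm c)) H₀₁ H₀₂ (C₁.e c).toLinearMap (C₂.e c).toLinearMap
      (C₁.isUnit_h c hc) (C₂.isUnit_h c hc) (C₁.map_F_eq c hc) (C₂.map_F_eq c hc) q
  form_eq c hc x y := tensor_form_eq_tmul_chart D₁ D₂ (C₁.e c) (C₂.e c) P₀₁.form P₀₂.form (C₁.form_eq c hc) (C₂.form_eq c hc) x y
  Λ := latticeTensor C₁.Λ C₂.Λ
  fg_Λ := C₁.fg_Λ.latticeTensor C₂.fg_Λ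
  e_toRat_mem c hc u := tensorTriv_toRat_mem D₁ D₂ (C₁.e c) (C₂.e c) (C₁.e_toRat_mem c hc) (C₂.e_toRat_mem c hc) u
  exists_e_toRat_eq c hc v hv := exists_tensorTriv_toRat_eq D₁ D₂ (C₁.e c) (C₂.e c) (C₁.exists_e_toRat_eq c hc) (C₂.exists_e_toRat_eq c hc) v hv
  κ := C₁.κ * C₂.κ
  κ_pos := mul_pos C₁.κ_pos C₂.κ_pos
  mul_hodgeNorm_le c hc w := by
    haveI : Module.Finite ℚ (D₁.V.fiber (ψ.symm c)) := D₁.finite_fiber _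
    haveI : Module.Finite ℚ (D₂.V.fiber (ψ.symm c)) := D₂.finite_fiber _
    exact Polarization.mul_hodgeNorm_map_baseChange_le (D₁.form (ψ.symm c)) (D₂.form (ψ.symm c)) P₀₁ P₀₂ (C₁.e c).toLinearMap
      (C₂.e c).toLinearMap C₁.κ_pos C₂.κ_pos (C₁.mul_hodgeNorm_le c hc) (C₂.mul_hodgeNorm_le c hc) w

/-- The trivialization of the tensor chart is `e₁ ⊗ e₂`. [cite: Schmid1973, §2] -/
@[simp] theorem tensor_e (c : ℂ) : (C₁.tensor C₂).e c = tensorTriv D₁ D₂ (C₁.e c) (C₂.e c) := rfl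

/-- The inverse frame of the tensor chart is `h₁ ⊗ h₂`. [cite: CattaniDeligneKaplan1995, §1 (p. 483)] -/
@[simp] theorem tensor_h (c : ℂ) : (C₁.tensor C₂).h c = tensorEnd (C₁.h c) (C₂.h c) := rfl

/-- The lattice of the tensor chart is `Λ₁ ⊗ Λ₂`. [cite: Schmid1973, §2] -/
@[simp] theorem tensor_Λ : (C₁.tensor C₂).Λ = latticeTensor C₁.Λ C₂.Λ := rfl

/-- The comparison constant of the tensor chart is `κ₁κ₂`. [cite: CattaniDeligneKaplan1995, §1 (p. 484)] -/
@[simp] theorem tensor_κ : (C₁.tensor C₂).κ = C₁.κ * C₂.κ := rfl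

end InteriorChart

/-! ## §3 Theorem 1.1 (`r = 1`) from bundled charts -/

section Global

variable (D : VHSData S k)

/-- **Cattani–Deligne–Kaplan, THEOREM 1.1 / COROLLARY 1.2 over a CURVE from BUNDLED CHARTS**: `S` preconnected; at every point an interior chart
(`InteriorChart`); puncture charts `C i : D.PunctureChart (σ i) (L i)` with open ends `σ i {Im z > A}` (`A ≥ A₀ i`) and a compact core.  Then
**`hodgeLocusOfNormLe D p K` is ALL of `S` or FINITE.** [cite: CattaniDeligneKaplan1995, Thm. 1.1, Cor. 1.2 (p. 484), Thm. 1.5 and «Proof of 1.5 ⟹ 1.1» (p. 485)] -/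
theorem hodgeLocusOfNormLe_eq_univ_or_finite_of_charts [PreconnectedSpace S] {p : ℤ} (hpk : p + p = k) (K : ℤ)
    (hint : ∀ x : S, ∃ (ψ : OpenPartialHomeomorph S ℂ) (H₀ : HodgeStructure V k) (P₀ : H₀.Polarization),
      x ∈ ψ.source ∧ Nonempty (D.InteriorChart ψ P₀))
    {ι : Type*} {σ : ι → ℂ → S} {L : ι → PolarizedLimitMixedHodgeStructure V k} (C : ∀ i, D.PunctureChart (σ i) (L i))
    (hopen : ∀ (i : ι) (A : ℝ), (C i).A₀ ≤ A → IsOpen (σ i '' {z : ℂ | A < z.im}))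
    (hcore : ∀ A : ι → ℝ, (∀ i, (C i).A₀ ≤ A i) → ∃ K₀ : Set S, IsCompact K₀ ∧ K₀ ∪ ⋃ i, σ i '' {z : ℂ | A i < z.im} = univ) :
    D.hodgeLocusOfNormLe p K = univ ∨ (D.hodgeLocusOfNormLe p K).Finite := by
  refine D.hodgeLocusOfNormLe_eq_univ_or_finite_of_local p K (fun x => ?_) σ (fun i => (C i).A₀) hopen hcore fun i => ?_
  · obtain ⟨ψ, H₀, P₀, hx, ⟨Cx⟩⟩ := hint x
    exact Cx.mem_nhds_or_eventually_not_mem hpk K hx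
  · obtain ⟨A, -, hA₀, hA⟩ := (C i).forall_mem_hodgeLocusOfNormLe_or_forall_not_mem hpk K
    exact ⟨A, hA₀, hA⟩

variable {X : Type*} [TopologicalSpace X] [CompactSpace X]

/-- **THEOREM 1.1 / COROLLARY 1.2 over a PUNCTURED COMPACT CURVE from BUNDLED CHARTS**: the open ends and the compact core supplied by a compactification
`j : S ↪ X` (`X` compact, `X ∖ j(S) ⊆ {pt i}`) with disc charts `φ i` at the punctures uniformised by the `σ i` (`j(σ i z) = (φ i)⁻¹(e^{2πiz})`).
[cite: CattaniDeligneKaplan1995, Thm. 1.1, Cor. 1.2 (p. 484), «Proof of 1.5 ⟹ 1.1» (p. 485), 2.3 (p. 487)] -/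
theorem hodgeLocusOfNormLe_eq_univ_or_finite_of_charts_of_compactification [PreconnectedSpace S] {p : ℤ} (hpk : p + p = k) (K : ℤ)
    (hint : ∀ x : S, ∃ (ψ : OpenPartialHomeomorph S ℂ) (H₀ : HodgeStructure V k) (P₀ : H₀.Polarization),
      x ∈ ψ.source ∧ Nonempty (D.InteriorChart ψ P₀))
    {ι : Type*} {σ : ι → ℂ → S} {L : ι → PolarizedLimitMixedHodgeStructure V k} (C : ∀ i, D.PunctureChart (σ i) (L i))
    {j : S → X} (hj : IsEmbedding j) (pt : ι → X) (hpS : ∀ i, pt i ∉ range j) (hcov : ∀ x : X, x ∉ range j → ∃ i, x = pt i)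
    (φ : ι → OpenPartialHomeomorph X ℂ) (hp : ∀ i, pt i ∈ (φ i).source) (hφp : ∀ i, φ i (pt i) = 0)
    (hball : ∀ i, Metric.ball (0 : ℂ) (Real.exp (-(2 * Real.pi * (C i).A₀))) ⊆ (φ i).target)
    (hσ : ∀ (i : ι) (z : ℂ), (C i).A₀ < z.im → j (σ i z) = (φ i).symm (Complex.exp (2 * Real.pi * Complex.I * z))) :
    D.hodgeLocusOfNormLe p K = univ ∨ (D.hodgeLocusOfNormLe p K).Finite :=
  D.hodgeLocusOfNormLe_eq_univ_or_finite_of_charts hpk K hint C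
    (Literature.Topology.isOpen_image_ends hj φ (fun i => (C i).A₀) hball σ hσ)
    (Literature.Topology.exists_isCompact_core hj pt hpS hcov φ hp hφp (fun i => (C i).A₀) hball σ hσ)

end Global

/-! ## §4 Theorem 1.1 (`r = 1`) for `D₁ ⊗ D₂` over a curve, from the charts of the factors -/

section GlobalTensor

variable {k₁ k₂ : ℤ} (D₁ : VHSData S k₁) (D₂ : VHSData S k₂)
variable {V₁ V₂ : Type} [AddCommGroup V₁] [Module ℚ V₁] [FiniteDimensional ℚ V₁] [AddCommGroup V₂] [Module ℚ V₂] [FiniteDimensional ℚ V₂]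

/-- **CDK THEOREM 1.1 / COROLLARY 1.2 (`r = 1`) FOR THE TENSOR PRODUCT `D₁ ⊗ D₂` OVER A CURVE, FROM THE CHARTS OF THE FACTORS.**  `S`
preconnected; at every point interior charts of `D₁` AND `D₂` on a common coordinate disc; at the ends puncture charts of `D₁`, `D₂` along common
uniformisations `σ i` (limits `L₁ i`, `L₂ i`), open ends beyond `max(A₀,₁, A₀,₂)` and a compact core.  Then for `p + p = k₁ + k₂`:
**the set of `s ∈ S` carrying a nonzero integral tensor `u ∈ V₁,ℤ,s ⊗ V₂,ℤ,s` of type `(p, p)` with `(Q₁ ⊗ Q₂)(u, u) ≤ K` is ALL of `S` or FINITE**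
(«`S^{(K)}` is an algebraic variety, finite over `S`» for the tensor variation; the charts of `D₁ ⊗ D₂` are `InteriorChart.tensor`, `PunctureChart.tensor`).
[cite: CattaniDeligneKaplan1995, Thm. 1.1, Cor. 1.2 (p. 484), Thm. 1.5 and «Proof of 1.5 ⟹ 1.1» (p. 485)] [cite: KlinglerOtwinowskaUrbanik2023, §1.1 (context)] -/
theorem hodgeLocusOfNormLe_tensor_eq_univ_or_finite [PreconnectedSpace S] {p : ℤ} (hpk : p + p = k₁ + k₂) (K : ℤ)
    (hint : ∀ x : S, ∃ (ψ : OpenPartialHomeomorph S ℂ) (H₀₁ : HodgeStructure V₁ k₁) (P₀₁ : H₀₁.Polarization) (H₀₂ : HodgeStructure V₂ k₂)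
      (P₀₂ : H₀₂.Polarization), x ∈ ψ.source ∧ Nonempty (D₁.InteriorChart ψ P₀₁) ∧ Nonempty (D₂.InteriorChart ψ P₀₂))
    {ι : Type*} {σ : ι → ℂ → S} {L₁ : ι → PolarizedLimitMixedHodgeStructure V₁ k₁} {L₂ : ι → PolarizedLimitMixedHodgeStructure V₂ k₂}
    (C₁ : ∀ i, D₁.PunctureChart (σ i) (L₁ i)) (C₂ : ∀ i, D₂.PunctureChart (σ i) (L₂ i))
    (hopen : ∀ (i : ι) (A : ℝ), max (C₁ i).A₀ (C₂ i).A₀ ≤ A → IsOpen (σ i '' {z : ℂ | A < z.im}))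
    (hcore : ∀ A : ι → ℝ, (∀ i, max (C₁ i).A₀ (C₂ i).A₀ ≤ A i) → ∃ K₀ : Set S, IsCompact K₀ ∧ K₀ ∪ ⋃ i, σ i '' {z : ℂ | A i < z.im} = univ) :
    (D₁.tensor D₂).hodgeLocusOfNormLe p K = univ ∨ ((D₁.tensor D₂).hodgeLocusOfNormLe p K).Finite := by
  haveI : HodgeTensorFacts.{0, 0} := hodgeTensorFacts_holds
  refine (D₁.tensor D₂).hodgeLocusOfNormLe_eq_univ_or_finite_of_charts hpk K (fun x => ?_) (fun i => (C₁ i).tensor (C₂ i)) hopen hcore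
  obtain ⟨ψ, H₀₁, P₀₁, H₀₂, P₀₂, hx, ⟨Cx₁⟩, ⟨Cx₂⟩⟩ := hint x
  exact ⟨ψ, H₀₁.tensor H₀₂, P₀₁.tensor P₀₂, hx, ⟨Cx₁.tensor Cx₂⟩⟩

variable {X : Type*} [TopologicalSpace X] [CompactSpace X]

/-- **CDK THEOREM 1.1 / COROLLARY 1.2 FOR `D₁ ⊗ D₂` OVER A PUNCTURED COMPACT CURVE, from the charts of the factors** (compactification `j : S ↪ X`,
disc charts at the punctures uniformised by the common `σ i`; the model works at every height `≥ a i`, `a i ≤ max(A₀,₁ i, A₀,₂ i)`).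
[cite: CattaniDeligneKaplan1995, Thm. 1.1, Cor. 1.2 (p. 484), «Proof of 1.5 ⟹ 1.1» (p. 485), 2.3 (p. 487)] -/
theorem hodgeLocusOfNormLe_tensor_eq_univ_or_finite_of_compactification [PreconnectedSpace S] {p : ℤ} (hpk : p + p = k₁ + k₂) (K : ℤ)
    (hint : ∀ x : S, ∃ (ψ : OpenPartialHomeomorph S ℂ) (H₀₁ : HodgeStructure V₁ k₁) (P₀₁ : H₀₁.Polarization) (H₀₂ : HodgeStructure V₂ k₂)
      (P₀₂ : H₀₂.Polarization), x ∈ ψ.source ∧ Nonempty (D₁.InteriorChart ψ P₀₁) ∧ Nonempty (D₂.InteriorChart ψ P₀₂))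
    {ι : Type*} {σ : ι → ℂ → S} {L₁ : ι → PolarizedLimitMixedHodgeStructure V₁ k₁} {L₂ : ι → PolarizedLimitMixedHodgeStructure V₂ k₂}
    (C₁ : ∀ i, D₁.PunctureChart (σ i) (L₁ i)) (C₂ : ∀ i, D₂.PunctureChart (σ i) (L₂ i))
    {j : S → X} (hj : IsEmbedding j) (pt : ι → X) (hpS : ∀ i, pt i ∉ range j) (hcov : ∀ x : X, x ∉ range j → ∃ i, x = pt i)
    (φ : ι → OpenPartialHomeomorph X ℂ) (hp : ∀ i, pt i ∈ (φ i).source) (hφp : ∀ i, φ i (pt i) = 0) (a : ι → ℝ)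
    (ha : ∀ i, a i ≤ max (C₁ i).A₀ (C₂ i).A₀) (hball : ∀ i, Metric.ball (0 : ℂ) (Real.exp (-(2 * Real.pi * a i))) ⊆ (φ i).target)
    (hσ : ∀ (i : ι) (z : ℂ), a i < z.im → j (σ i z) = (φ i).symm (Complex.exp (2 * Real.pi * Complex.I * z))) :
    (D₁.tensor D₂).hodgeLocusOfNormLe p K = univ ∨ ((D₁.tensor D₂).hodgeLocusOfNormLe p K).Finite := by
  have hball' : ∀ i, Metric.ball (0 : ℂ) (Real.exp (-(2 * Real.pi * max (C₁ i).A₀ (C₂ i).A₀))) ⊆ (φ i).target := fun i =>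
    (Metric.ball_subset_ball (Real.exp_le_exp.2 (by nlinarith [ha i, Real.pi_pos]))).trans (hball i)
  have hσ' : ∀ (i : ι) (z : ℂ), max (C₁ i).A₀ (C₂ i).A₀ < z.im → j (σ i z) = (φ i).symm (Complex.exp (2 * Real.pi * Complex.I * z)) :=
    fun i z hz => hσ i z ((ha i).trans_lt hz)
  exact D₁.hodgeLocusOfNormLe_tensor_eq_univ_or_finite D₂ hpk K hint C₁ C₂
    (Literature.Topology.isOpen_image_ends hj φ (fun i => max (C₁ i).A₀ (C₂ i).A₀) hball' σ hσ')
    (Literature.Topology.exists_isCompact_core hj pt hpS hcov φ hp hφp (fun i => max (C₁ i).A₀ (C₂ i).A₀) hball' σ hσ')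

end GlobalTensor

end Motives.VHSData

end Literature.AlgebraicGeometry

end
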